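import Summits.NavierStokesRegularity.NavierStokesRegularity.Theses.TerminalTrace
import Literature.Analysis.FluidPDE.SereginSverak2002FinalEnergyIff
import HarnessLib.Audit

/-!
# Birth skeleton (BC3) of the crux `TerminalTrace.NoTraceConcentration`

Crux item `stmt-NavierStokesRegularity-18381` (decl
`Summit.NavierStokesRegularity.NavierStokesRegularity.Theses.TerminalTrace.NoTraceConcentration`, crux rank 3 —
conjunct (B) of route `route-NavierStokesRegularity-TerminalTrace`, re-audit bin HONEST). Tree path
`Cruxes/NoTraceConcentration/Lines/birth.lean`; registrar `planner-skel-stmt-NavierStokesRegularity-18381-0`,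
2026-08-17. Nothing here is new mathematics: it types the route's OWN declared layer-1 cut of (B) (route header,
TWO-LAYER PLAN: "NoTraceConcentration ⇐ BoundedFinalDensity (u T ∈ M^{2,1} locally at every point) →
DensityVanishesOfBounded → NoTraceConcentration (grade split; k = 2)"; the opening planner's BC3 file of the same
shape could not be `crux write`-n from a plan-lens unit and survives only as the evidence note
`NoTraceConcentration_birth_pub.lean` on the item), sharpened in one respect: both stubs are stated only at points
that are NOT backward bounded, because at a backward-bounded point the conclusion is already the tree theorem
`SereginSverak2002.tendsto_scaledEnergy_final_of_isBackwardBoundedAt` — the composition below makes that case split,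
so the registered stubs carry exactly "the content at the 𝒫¹-null singular set Σ_T" named in the crux docstring.

THE CRUX (B). Frame: `ν > 0`, `T > 0`, `(u, p)` classical on `ℝ³ × [0, T)`, Leray–Hopf on `[0, T]` from the rapidly
decaying datum `u 0` (so `u T` is the weak-`L²` terminal state). Claim: for EVERY `x₀`,
FE(x₀): `r⁻¹ ∫_{B(x₀,r)} ‖u T x‖² dx → 0` as `r → 0⁺` — a first-time singularity, if any, leaves no residue in
scaled energy density of the final value.

THE CUT (two named stubs; "backward bounded at (T,x₀)" is written INLINE,
`∃ r > 0, ∃ C, ∀ t ∈ Ioo (T - r²) T, ∀ x ∈ ball x₀ r, ‖u t x‖ ≤ C` — literally the body of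
`Literature.Analysis.FluidPDE.IsBackwardBoundedAt u T x₀`, as in the route's `TraceDensityCriterion`):

* `stub_boundedFinalDensity` — NO TAIL (Morrey grade). In the frame, at every point `x₀` that is not backward
  bounded, the final value lies in the local Morrey class `M^{2,1}` at `x₀`:
  `∃ M r₀, 0 < r₀ ∧ ∀ r ∈ (0, r₀), r⁻¹ ∫_{B(x₀,r)} ‖u T‖² ≤ M`. Enemy: a β-tailed collapse (β < 1/2) leaves the trace
  `|x - x₀|^{-(1-β)/β}` of density `r^{(4β-2)/β} → ∞` (route NUMBERS). Known cell: Type I in time ⇒ Type I in space,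
  `u ∈ L^∞_t M^{2,1}` up to the first blow-up time (Leslie–Shvydkoy, arXiv:1705.04420, Prop. 3.2 with Prop. 4.2 and
  Rem. 3.3), which passes to the weak-`L²` trace `u T` by lower semicontinuity exactly as in the tree lemma
  `SereginSverak2002.setIntegral_ball_norm_sq_final_le_of_bound`. Size: XL / open (an a-priori statement at the
  critical scaling with no rate hypothesis).
* `stub_densityVanishesOfBounded` — NO INVERSE-DISTANCE SCAR (bounded ⇒ vanishing). In the frame, at every point
  `x₀` that is not backward bounded, a bounded scaled density of `u T` at `x₀` already tends to `0`. Enemy: a Type-I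
  (self-similar-rate) first-time blow-up, whose trace `c|x - x₀|⁻¹` has CONSTANT density `4πc²` (the model scar of
  the landed Negative lemma `Theorems.NoTraceConcentration.Negative.scaledEnergy_inv_norm_sq_ge`); so this stub
  CONTAINS the exclusion of Type-I first-time blow-up from Schwartz-class data (barrier
  `Literature.Barriers.NavierStokesRegularity.CriticalNormBlowupNecessity`: excluded by nothing in print; Hou 2022
  numerics), and by the negatives index the averaged-class Type-I exclusion `PerpetualPump.Thesis` is REFUTED
  (`Theorems.not_Thesis`), so any proof must use non-averaged structure (barrier `TaoAveragedBlowup`, met not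
  evaded — as the route header concedes for (B) as a whole). Size: open-problem.

`NoTraceConcentration_of : TerminalTrace.NoTraceConcentration` is the ONLY theorem of this file concluding the crux
(A12 layer invariant: conclusion = the crux BY NAME, no `Prop` hypotheses, `sorry` only inside the two declared
stubs, which it uses by name). Proof: fix the frame and `x₀`; `by_cases` on backward boundedness at `(T, x₀)`:
if yes, the tree theorem `tendsto_scaledEnergy_final_of_isBackwardBoundedAt hT hLH` (the inline hypothesis IS
`IsBackwardBoundedAt u T x₀` by `δ`-unfolding); if no, `stub_densityVanishesOfBounded … (stub_boundedFinalDensity …)`.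
The hypotheses form `NoTraceConcentration_of_hyps : <stub₁-sig> → <stub₂-sig> → NoTraceConcentration` (same proof,
axioms ⊆ {propext, Classical.choice, Quot.sound}, no placeholder) is kept OUT of this file so that the skeleton
audit sees one candidate; it is the registrar's evidence file `bc/NoTraceConcentration_birth_closed.lean`.

HONEST NOTE ON THE SEAM. The seam is a grade ladder at the singular set, not an analytic reduction: stub 1 removes
tails (infinite density), stub 2 removes the marginal `|x|⁻¹` grade (positive finite density); neither is cheaply
the crux or the summit. BC3 probes (registrar folder `bc/probe_*.lean`, each stub stated verbatim as a hypothesis,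
imports = the route file + the landed Negative lemma only): for each stub `S`, `S → NoTraceConcentration` and
`S → NavierStokesRegularity` by `first | exact? | simpa | aesop` (payload battery) and by the unfolded BC.md battery
`first | exact? | simpa [defs] | (unfold defs; simpa) | (unfold defs; aesop) | aesop` at `maxHeartbeats 400000` —
8/8 FAIL (stub 1: "unsolved goals", `aesop: failed to prove the goal after exhaustive search` 4/4; stub 2: 1/4 the
same, 3/4 heartbeat exhaustion at 4·10⁵), plus 9/9 supplementary single-tactic probes for stub 2 at 10⁶ heartbeats
(`exact?`: "could not close the goal" 3/3; `aesop`: exhaustive-search failure 3/3; `simpa using h`: type mismatch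
3/3); raw outputs in `Lines/birth.md`. Converse direction (informational): the crux implies stub 2 trivially (a
piece of a tight split; term in the closed evidence file) and implies stub 1 only through "convergent ⇒ eventually
bounded" (not found by the battery).

Disproof used: no `Disproof.lean` exists for this crux yet (`ledger crux ls`: no workfiles before this one). Landed
Negative lemma honoured: `noTraceConcentration_false_without_lerayHopf` (the crux minus `IsLerayHopfOn` is false: the
slice `u T` is then unpinned) — BOTH stubs keep the full frame including `IsLerayHopfOn T ν 0 (u 0) u`, and read
`u T` only as the weak-`L²` terminal state. Negatives index (`ledger negatives --problem NavierStokesRegularity`,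
4 entries: FiniteTangentModuli, PerpetualPump.Thesis, CorrectorSolvable, BlowupClayNonuniqueness): no refuted
statement is an instance or a rewording of either stub.
-/

noncomputable section

namespace Summit.NavierStokesRegularity.NavierStokesRegularity.Cruxes.NoTraceConcentration.Birth

open MeasureTheory Filter Set Metric
open Literature.Analysis.FluidPDE

set_option linter.unusedVariables false
set_option linter.dupNamespace false

/-- **stub 1 — `stub_boundedFinalDensity` (XL, OPEN; "no tail", the Morrey grade `M^{2,1}` of the final value
at the singular set).** In the frame of the crux, at every point `x₀` such that `u` is NOT bounded on any backward
cylinder `(T - r², T) × B(x₀, r)`, the scaled energy density of the final value is bounded on small balls: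
`∃ M r₀, 0 < r₀ ∧ ∀ r ∈ (0, r₀), r⁻¹ ∫_{B(x₀,r)} ‖u T x‖² dx ≤ M`. Known in the Type-I-in-time cell
(Leslie–Shvydkoy: Type I in time ⇒ `u ∈ L^∞_t M^{2,1}`, passed to the weak trace); fails for β-tailed collapse
profiles, β < 1/2, none of which is known to occur. [cite: arXiv:1705.04420, Prop. 3.2, Prop. 4.2, Rem. 3.3]
[status: open] -/
theorem stub_boundedFinalDensity :
    ∀ (ν T : ℝ), 0 < ν → 0 < T →
      ∀ (u : ℝ → EuclideanSpace ℝ (Fin 3) → EuclideanSpace ℝ (Fin 3))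
        (p : ℝ → EuclideanSpace ℝ (Fin 3) → ℝ),
      Literature.Analysis.FluidPDE.IsClassicalNSSolutionOn (Set.Ico 0 T) ν 0 u p →
      Literature.Analysis.FluidPDE.IsLerayHopfOn T ν 0 (u 0) u →
      Literature.Analysis.FluidPDE.HasRapidSpatialDecay (u 0) →
      ∀ x₀ : EuclideanSpace ℝ (Fin 3),
        ¬ (∃ r > 0, ∃ C : ℝ, ∀ t ∈ Set.Ioo (T - r ^ 2) T, ∀ x ∈ Metric.ball x₀ r, ‖u t x‖ ≤ C) →
        ∃ (M r₀ : ℝ), 0 < r₀ ∧ ∀ r : ℝ, 0 < r → r < r₀ →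
          r⁻¹ * ∫ x in Metric.ball x₀ r, ‖u T x‖ ^ 2 ≤ M := by
  sorry

/-- **stub 2 — `stub_densityVanishesOfBounded` (open-problem; "no inverse-distance scar", bounded ⇒ vanishing
density at the singular set).** In the frame of the crux, at every point `x₀` such that `u` is NOT bounded on any
backward cylinder at `(T, x₀)`, IF the scaled energy density of the final value is bounded on small balls about
`x₀` THEN it tends to `0`: `r⁻¹ ∫_{B(x₀,r)} ‖u T x‖² dx → 0` as `r → 0⁺`. Contains the exclusion of Type-I
first-time blow-up from rapidly decaying data (a `c|x - x₀|⁻¹` scar has constant density `4πc²`,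
`Theorems.NoTraceConcentration.Negative.scaledEnergy_inv_norm_sq_ge`); refuted in the averaged class
(`Theorems.not_Thesis` for `PerpetualPump.Thesis`), so non-averaged structure is required.
[cite: BarkerPrange2021, Prop. 4.1; arXiv:2510.20757, §1.2.2] [status: open] -/
theorem stub_densityVanishesOfBounded :
    ∀ (ν T : ℝ), 0 < ν → 0 < T →
      ∀ (u : ℝ → EuclideanSpace ℝ (Fin 3) → EuclideanSpace ℝ (Fin 3))
        (p : ℝ → EuclideanSpace ℝ (Fin 3) → ℝ),
      Literature.Analysis.FluidPDE.IsClassicalNSSolutionOn (Set.Ico 0 T) ν 0 u p →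
      Literature.Analysis.FluidPDE.IsLerayHopfOn T ν 0 (u 0) u →
      Literature.Analysis.FluidPDE.HasRapidSpatialDecay (u 0) →
      ∀ x₀ : EuclideanSpace ℝ (Fin 3),
        ¬ (∃ r > 0, ∃ C : ℝ, ∀ t ∈ Set.Ioo (T - r ^ 2) T, ∀ x ∈ Metric.ball x₀ r, ‖u t x‖ ≤ C) →
        (∃ (M r₀ : ℝ), 0 < r₀ ∧ ∀ r : ℝ, 0 < r → r < r₀ →
          r⁻¹ * ∫ x in Metric.ball x₀ r, ‖u T x‖ ^ 2 ≤ M) →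
        Filter.Tendsto (fun r : ℝ => r⁻¹ * ∫ x in Metric.ball x₀ r, ‖u T x‖ ^ 2)
          (nhdsWithin 0 (Set.Ioi 0)) (nhds 0) := by
  sorry

/-- **Birth composition (the skeleton theorem).** The crux BY NAME from the two registered stubs, used by name:
at a backward-bounded point `(T, x₀)` the final value has no scaled-energy concentration by the tree theorem
`SereginSverak2002.tendsto_scaledEnergy_final_of_isBackwardBoundedAt` (the inline case hypothesis is
`IsBackwardBoundedAt u T x₀` unfolded); at every other point, stub 1 bounds the density and stub 2 sends it to `0`.
[cite: SereginSverak2002, Thm. 2.2 (⇒ direction, folklore)] -/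
theorem NoTraceConcentration_of :
    Summit.NavierStokesRegularity.NavierStokesRegularity.Theses.TerminalTrace.NoTraceConcentration := by
  intro ν T hν hT u p hcl hLH hdec x₀
  by_cases hreg : ∃ r > 0, ∃ C : ℝ, ∀ t ∈ Set.Ioo (T - r ^ 2) T, ∀ x ∈ Metric.ball x₀ r, ‖u t x‖ ≤ C
  · exact SereginSverak2002.tendsto_scaledEnergy_final_of_isBackwardBoundedAt hT hLH hreg
  · exact stub_densityVanishesOfBounded ν T hν hT u p hcl hLH hdec x₀ hreg
      (stub_boundedFinalDensity ν T hν hT u p hcl hLH hdec x₀ hreg)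

end Summit.NavierStokesRegularity.NavierStokesRegularity.Cruxes.NoTraceConcentration.Birth

end
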